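import Mathlib
import Summits.ResolutionOfSingularities.ResolutionOfSingularities.Theorems.WeightedInvariantLocalWeightedDropNCResCurveGraphDefs

/-!
# `WeightedInvariant.LocalWeightedDrop`: NC-RESOLUTION SETTINGS for the TOT₂ line (S-SET), part 15 — GRAPH CURVES: the calculus of the
# permissibility ideal `InOffIdeal`, the tangent as an invariance vector, and the letter-preserving curve move at a graph curve

Crux item stmt-ResolutionOfSingularities-8899 `LocalWeightedDrop` (route `ResolutionOfSingularities/WeightedInvariant`), ENGINE skeleton v32,
residual `stub_spaceNCRankDrop`; TOT2-LINE (res-L1-w43-lead-1) inner dispatch, sub-regime S-E1-CURVE (gap note `L/res-L1-w43-stub-1/E1-CURVE-GAP.md`).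
[OURS · L1 W4.3 · chain w43 · seat res-L1-w43-stub-1 gen 6; def-free on part 14's definitions; nothing here is a statement of any manuscript;
AI-produced, gate-checked, weaker than expert review.]

* `InOffIdeal.mono/.add/.neg/.mul/.pow/.finsetProd/.finsuppProd/.of_X_pow_mul_self/.mul_left`, `inOffIdeal_X_of_ne`, `inOffIdeal_zero_right` —
  `(x_j : j ≠ i)^c` is an ideal filtration, insensitive to powers of `x_i`.
* **`InOffIdeal.subst`** — TRANSPORT: if every non-graph component of a substitution family lies in `(y_j : j ≠ i')`, the substitution maps
  `(x_j : j ≠ i)^c` into `(y_j : j ≠ i')^c` (used twice: the blow-up chart in graph coordinates, and re-presentation of a curve).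
* **`initEval_add_single_of_inOffIdeal`**, **`tangent_inv`** — the graph letter's direction is an invariance vector of the degree-`c` form of
  `G ∈ (x_j : j ≠ i)^c`; hence, for `g` with `Φ_C^* g ∈ (x_j : j ≠ i)^c` (`Φ_C` the graph shear), THE TANGENT OF `C` IS AN INVARIANCE VECTOR OF
  `in_c g` (directrix transport `inv_subst_legal`, part 13).
* **`dWinsTo_headDrop_of_graph_terminal`** — THE TERMINAL MOVE: if every letter `l ≠ i` contains the curve (`φ_l = 0`), the graph shear is
  letter-preserving, the curve move `(Φ_C, 𝟙_{j ≠ i})` is B-permissible (`isBPermissible_of_totalO_weightedOrder`) and, at apex dimension `≤ 1`,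
  wins the head phase in one move (`dWinsTo_headDrop_of_apexLine_curve`, part 13).
-/

set_option linter.dupNamespace false -- mandated namespace of this single-conjunct summit

noncomputable section

namespace Summit.ResolutionOfSingularities.ResolutionOfSingularities.Theorems

namespace TameFourTupleDrop

namespace GraphCurve

open MvPowerSeries Literature.AlgebraicGeometry.Resolution

variable {k : Type} [Field k] {m : ℕ}

-- BODY-START
/-! ## The permissibility ideal is an ideal filtration -/

section Ideal

variable {i : Fin (m + 1)}

/-- Monotonicity in the order. -/
theorem InOffIdeal.mono {c c' : ℕ} {G : MvPowerSeries (Fin (m + 1)) k} (h : c' ≤ c) (hG : InOffIdeal i c G) : InOffIdeal i c' G :=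
  fun E hE => h.trans (hG E hE)

/-- Everything lies in the `0`-th power. -/
theorem inOffIdeal_zero_right (i : Fin (m + 1)) (G : MvPowerSeries (Fin (m + 1)) k) : InOffIdeal i 0 G := fun _ _ => Nat.zero_le _

/-- Zero lies in every power. -/
theorem inOffIdeal_zero (i : Fin (m + 1)) (c : ℕ) : InOffIdeal i c (0 : MvPowerSeries (Fin (m + 1)) k) := fun _ hE => absurd (map_zero _) hE

/-- Closed under addition. -/
theorem InOffIdeal.add {c : ℕ} {F G : MvPowerSeries (Fin (m + 1)) k} (hF : InOffIdeal i c F) (hG : InOffIdeal i c G) :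
    InOffIdeal i c (F + G) := by
  intro E hE
  rw [map_add] at hE
  by_cases hF0 : coeff E F = 0
  · rw [hF0, zero_add] at hE; exact hG E hE
  · exact hF E hF0

/-- Closed under negation. -/
theorem InOffIdeal.neg {c : ℕ} {G : MvPowerSeries (Fin (m + 1)) k} (hG : InOffIdeal i c G) : InOffIdeal i c (-G) :=
  fun E hE => hG E (by rwa [map_neg, neg_ne_zero] at hE)

/-- Closed under subtraction. -/
theorem InOffIdeal.sub {c : ℕ} {F G : MvPowerSeries (Fin (m + 1)) k} (hF : InOffIdeal i c F) (hG : InOffIdeal i c G) :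
    InOffIdeal i c (F - G) := by
  rw [sub_eq_add_neg]; exact hF.add hG.neg

/-- Closed under finite sums. -/
theorem InOffIdeal.finsetSum {ι : Type*} {c : ℕ} (s : Finset ι) (f : ι → MvPowerSeries (Fin (m + 1)) k)
    (h : ∀ x ∈ s, InOffIdeal i c (f x)) : InOffIdeal i c (∑ x ∈ s, f x) := by
  classical
  induction s using Finset.induction_on with
  | empty => rw [Finset.sum_empty]; exact inOffIdeal_zero i c
  | insert a s ha ih =>
    rw [Finset.sum_insert ha]
    exact (h a (Finset.mem_insert_self a s)).add (ih fun x hx => h x (Finset.mem_insert_of_mem hx))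

/-- MULTIPLICATIVITY: `(x_j)^a · (x_j)^b ⊆ (x_j)^{a+b}`. -/
theorem InOffIdeal.mul {a b : ℕ} {F G : MvPowerSeries (Fin (m + 1)) k} (hF : InOffIdeal i a F) (hG : InOffIdeal i b G) :
    InOffIdeal i (a + b) (F * G) := by
  classical
  intro E hE
  rw [coeff_mul] at hE
  obtain ⟨p, hp, hne⟩ := Finset.exists_ne_zero_of_sum_ne_zero hE
  have h1 : coeff p.1 F ≠ 0 := fun h => hne (by rw [h, zero_mul])
  have h2 : coeff p.2 G ≠ 0 := fun h => hne (by rw [h, mul_zero])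
  have hsum : p.1 + p.2 = E := Finset.HasAntidiagonal.mem_antidiagonal.mp hp
  rw [← hsum, offDeg_add]
  exact add_le_add (hF _ h1) (hG _ h2)

/-- Left multiplication by anything keeps the power. -/
theorem InOffIdeal.mul_left {c : ℕ} {G : MvPowerSeries (Fin (m + 1)) k} (hG : InOffIdeal i c G) (U : MvPowerSeries (Fin (m + 1)) k) :
    InOffIdeal i c (U * G) := by
  have h := (inOffIdeal_zero_right i U).mul hG
  rwa [zero_add] at h

/-- Powers. -/
theorem InOffIdeal.pow {a : ℕ} {F : MvPowerSeries (Fin (m + 1)) k} (hF : InOffIdeal i a F) (n : ℕ) : InOffIdeal i (n * a) (F ^ n) := by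
  induction n with
  | zero => rw [zero_mul, pow_zero]; exact inOffIdeal_zero_right i 1
  | succ n ih => rw [pow_succ, Nat.succ_mul]; exact ih.mul hF

/-- Finite products. -/
theorem InOffIdeal.finsetProd {ι : Type*} (s : Finset ι) (f : ι → MvPowerSeries (Fin (m + 1)) k) (a : ι → ℕ)
    (h : ∀ x ∈ s, InOffIdeal i (a x) (f x)) : InOffIdeal i (∑ x ∈ s, a x) (∏ x ∈ s, f x) := by
  classical
  induction s using Finset.induction_on with
  | empty => rw [Finset.sum_empty, Finset.prod_empty]; exact inOffIdeal_zero_right i 1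
  | insert b s hb ih =>
    rw [Finset.sum_insert hb, Finset.prod_insert hb]
    exact (h b (Finset.mem_insert_self b s)).mul (ih fun x hx => h x (Finset.mem_insert_of_mem hx))

/-- A letter other than the graph letter lies in the first power. -/
theorem inOffIdeal_X_of_ne {j : Fin (m + 1)} (h : j ≠ i) : InOffIdeal i 1 (X j : MvPowerSeries (Fin (m + 1)) k) := by
  intro E hE
  rw [coeff_X] at hE
  split_ifs at hE with hEj
  · rw [hEj, offDeg_single_of_ne h]
  · exact absurd rfl hE

/-- CANCELLATION OF POWERS OF THE GRAPH LETTER: `x_i^a · G ∈ (x_j)^c ⇒ G ∈ (x_j)^c`. -/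
theorem InOffIdeal.of_X_pow_mul_self {c a : ℕ} {G : MvPowerSeries (Fin (m + 1)) k} (h : InOffIdeal i c (X i ^ a * G)) : InOffIdeal i c G := by
  intro E hE
  have h1 : coeff (Finsupp.single i a + E) (X i ^ a * G) ≠ 0 := by
    rw [X_pow_eq, coeff_add_monomial_mul, one_mul]; exact hE
  have h2 := h _ h1
  rwa [offDeg_add, offDeg_single_self, zero_add] at h2

/-! ## Transport under substitution -/

/-- The `Finsupp.prod` of powers of a family member-wise in `(y_j : j ≠ i')^{e_j}` lies in `(y_j)^{Σ D_j e_j}`. -/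
theorem InOffIdeal.finsuppProd {n : ℕ} {i' : Fin (n + 1)} {σ : Type*} (D : σ →₀ ℕ) (Λ : σ → MvPowerSeries (Fin (n + 1)) k) (e : σ → ℕ)
    (h : ∀ j, InOffIdeal i' (e j) (Λ j)) : InOffIdeal i' (∑ j ∈ D.support, D j * e j) (D.prod fun j n => Λ j ^ n) := by
  unfold Finsupp.prod
  exact InOffIdeal.finsetProd _ _ _ fun j _ => (h j).pow (D j)

/-- **TRANSPORT UNDER SUBSTITUTION.**  If `S ∈ (x_j : j ≠ i)^c` and every component `Λ_j`, `j ≠ i`, of a substitution family lies in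
`(y_j : j ≠ i')` (the graph letter's component `Λ_i` is arbitrary), then `S(Λ) ∈ (y_j : j ≠ i')^c`. -/
theorem InOffIdeal.subst {n : ℕ} {i' : Fin (n + 1)} {c : ℕ} {S : MvPowerSeries (Fin (m + 1)) k} (hS : InOffIdeal i c S)
    (Λ : Fin (m + 1) → MvPowerSeries (Fin (n + 1)) k) (hΛ : HasSubst Λ) (hoff : ∀ j, j ≠ i → InOffIdeal i' 1 (Λ j)) :
    InOffIdeal i' c (subst Λ S) := by
  classical
  intro E hE
  by_contra hlt
  rw [not_le] at hlt
  apply hE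
  rw [coeff_subst hΛ S E]
  -- every term of the (finite) sum vanishes
  have hterm : ∀ D : Fin (m + 1) →₀ ℕ, coeff D S • coeff E (D.prod fun j n => Λ j ^ n) = 0 := by
    intro D
    by_cases hD : coeff D S = 0
    · rw [hD, zero_smul]
    · have hc : c ≤ offDeg i D := hS D hD
      -- the product lies in `(y_j)^{offDeg_i D}`
      have hprod : InOffIdeal i' (∑ j ∈ D.support, D j * (if j = i then 0 else 1)) (D.prod fun j n => Λ j ^ n) :=
        InOffIdeal.finsuppProd D Λ (fun j => if j = i then 0 else 1) fun j => by
          by_cases hj : j = i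
          · rw [if_pos hj]; exact inOffIdeal_zero_right i' _
          · rw [if_neg hj]; exact hoff j hj
      have hsum : offDeg i D ≤ ∑ j ∈ D.support, D j * (if j = i then 0 else 1) := by
        rw [offDeg]
        calc ∑ j ∈ Finset.univ.erase i, D j = ∑ j ∈ Finset.univ.erase i, D j * (if j = i then 0 else 1) :=
              Finset.sum_congr rfl fun j hj => by rw [if_neg (Finset.ne_of_mem_erase hj), mul_one]
          _ ≤ ∑ j ∈ Finset.univ, D j * (if j = i then 0 else 1) :=
              Finset.sum_le_sum_of_subset_of_nonneg (Finset.erase_subset _ _) fun _ _ _ => Nat.zero_le _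
          _ = ∑ j ∈ D.support, D j * (if j = i then 0 else 1) := by
              rw [← Finset.sum_subset (Finset.subset_univ D.support)]
              intro j _ hj
              rw [Finsupp.notMem_support_iff.mp hj, zero_mul]
      have hzero : coeff E (D.prod fun j n => Λ j ^ n) = 0 := by
        by_contra hne
        exact absurd ((hc.trans hsum).trans (hprod E hne)) (not_le.mpr hlt)
      rw [hzero, smul_zero]
  rw [finsum_congr hterm, finsum_zero]

/-! ## The graph letter's direction is an invariance vector -/

/-- A monomial of total degree `c` with off-`i` degree `≥ c` has `i`-exponent `0`. -/
theorem apply_eq_zero_of_degree_eq_of_le_offDeg {E : Fin (m + 1) →₀ ℕ} {c : ℕ} (hdeg : E.degree = c) (hoff : c ≤ offDeg i E) : E i = 0 := by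
  have h := offDeg_add_apply i E
  omega

/-- **THE GRAPH LETTER'S DIRECTION IS AN INVARIANCE VECTOR** of the degree-`c` form of `G ∈ (x_j : j ≠ i)^c`: the degree-`c` monomials of `G`
do not involve `x_i`. -/
theorem initEval_add_single_of_inOffIdeal {c : ℕ} {G : MvPowerSeries (Fin (m + 1)) k} (hG : InOffIdeal i c G) (v : Fin (m + 1) → k) (t : k) :
    CobordantChart.initEval (fun _ : Fin (m + 1) => 1) (v + Pi.single i t) c G =
      CobordantChart.initEval (fun _ : Fin (m + 1) => 1) v c G := by
  unfold CobordantChart.initEval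
  refine finsum_congr fun D => ?_
  split_ifs with hw
  · by_cases hD : coeff D G = 0
    · rw [hD, zero_mul, zero_mul]
    · have hdeg : D.degree = c := by rw [Finsupp.degree_eq_weight_one]; exact hw
      have hDi : D i = 0 := apply_eq_zero_of_degree_eq_of_le_offDeg hdeg (hG D hD)
      congr 1
      refine Finset.prod_congr rfl fun j _ => ?_
      by_cases hj : j = i
      · rw [hj, hDi, pow_zero, pow_zero]
      · rw [Pi.add_apply, Pi.single_eq_of_ne hj, add_zero]
  · rfl

/-- The same with a scalar multiple of the direction. -/
theorem inv_single_of_inOffIdeal {c : ℕ} {G : MvPowerSeries (Fin (m + 1)) k} (hG : InOffIdeal i c G) (t : k) (v : Fin (m + 1) → k) :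
    CobordantChart.initEval (fun _ : Fin (m + 1) => 1) (v + t • Pi.single i (1 : k)) c G =
      CobordantChart.initEval (fun _ : Fin (m + 1) => 1) v c G := by
  rw [← Pi.single_smul', smul_eq_mul, mul_one]
  exact initEval_add_single_of_inOffIdeal hG v t

end Ideal

/-! ## The tangent of a permissible graph curve is an invariance vector of `in_c g` -/

/-- **THE TANGENT IS AN INVARIANCE VECTOR.**  If the graph shear's pull-back `Φ_C^* g` lies in `(x_j : j ≠ i)^c` with `c = ord g` (the curve `C`
is permissible for `g` at order `c`), then the tangent direction of `C` is an invariance vector of the degree-`c` form of `g` (`T_x C ⊆ Dir`). -/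
theorem tangent_inv {i : Fin (m + 1)} {φ : Fin (m + 1) → PowerSeries k} (hφ : ∀ j, j ≠ i → PowerSeries.constantCoeff (φ j) = 0)
    {g : MvPowerSeries (Fin (m + 1)) k} {c : ℕ} (hgc : g.order = c) (hperm : InOffIdeal i c (subst (shear i φ) g))
    (v : Fin (m + 1) → k) :
    CobordantChart.initEval (fun _ : Fin (m + 1) => 1) (v + tangent i φ) c g =
      CobordantChart.initEval (fun _ : Fin (m + 1) => 1) v c g := by
  rw [← linMat_shear_mulVec_single i φ]
  exact inv_subst_legal (shear i φ) (constantCoeff_shear hφ) (isUnit_det_linMat_shear hφ) g hgc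
    (fun v' => initEval_add_single_of_inOffIdeal hperm v' 1) v

/-- Scalar multiples of the tangent are invariance vectors. -/
theorem tangent_smul_inv {i : Fin (m + 1)} {φ : Fin (m + 1) → PowerSeries k} (hφ : ∀ j, j ≠ i → PowerSeries.constantCoeff (φ j) = 0)
    {g : MvPowerSeries (Fin (m + 1)) k} {c : ℕ} (hgc : g.order = c) (hperm : InOffIdeal i c (subst (shear i φ) g)) (t : k)
    (v : Fin (m + 1) → k) :
    CobordantChart.initEval (fun _ : Fin (m + 1) => 1) (v + t • tangent i φ) c g =
      CobordantChart.initEval (fun _ : Fin (m + 1) => 1) v c g := by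
  have h := inv_subst_legal (shear i φ) (constantCoeff_shear hφ) (isUnit_det_linMat_shear hφ) g hgc
    (u := Pi.single i t) (fun v' => initEval_add_single_of_inOffIdeal hperm v' t) v
  rwa [show (Pi.single i t : Fin (m + 1) → k) = t • Pi.single i 1 by rw [← Pi.single_smul', smul_eq_mul, mul_one],
    Matrix.mulVec_smul, linMat_shear_mulVec_single] at h

/-- **AT APEX DIMENSION ≤ 1, EVERY INVARIANCE VECTOR IS A MULTIPLE OF THE TANGENT.** -/
theorem eq_smul_tangent_of_inv {i : Fin (m + 1)} {φ : Fin (m + 1) → PowerSeries k} (hφ : ∀ j, j ≠ i → PowerSeries.constantCoeff (φ j) = 0)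
    {g : MvPowerSeries (Fin (m + 1)) k} {c : ℕ} (hgc : g.order = c) (hperm : InOffIdeal i c (subst (shear i φ) g))
    (hcol : ∀ u₁ u₂ : Fin (m + 1) → k,
      (∀ v, CobordantChart.initEval (fun _ : Fin (m + 1) => 1) (v + u₁) c g = CobordantChart.initEval (fun _ : Fin (m + 1) => 1) v c g) →
      (∀ v, CobordantChart.initEval (fun _ : Fin (m + 1) => 1) (v + u₂) c g = CobordantChart.initEval (fun _ : Fin (m + 1) => 1) v c g) →
      ∃ α β : k, (α ≠ 0 ∨ β ≠ 0) ∧ α • u₁ + β • u₂ = 0)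
    {u : Fin (m + 1) → k}
    (hu : ∀ v, CobordantChart.initEval (fun _ : Fin (m + 1) => 1) (v + u) c g = CobordantChart.initEval (fun _ : Fin (m + 1) => 1) v c g) :
    u = u i • tangent i φ := by
  obtain ⟨α, β, hαβ, hlin⟩ := hcol u (tangent i φ) hu (tangent_inv hφ hgc hperm)
  have hα : α ≠ 0 := by
    intro hα
    rw [hα, zero_smul, zero_add] at hlin
    rcases hαβ with h | h
    · exact h hα
    · exact h (smul_eq_zero.mp hlin |>.resolve_right (tangent_ne_zero i φ))
  have hu' : u = (-β / α) • tangent i φ := by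
    have h1 : α • u = -(β • tangent i φ) := eq_neg_of_add_eq_zero_left hlin
    calc u = α⁻¹ • (α • u) := by rw [smul_smul, inv_mul_cancel₀ hα, one_smul]
      _ = (-β / α) • tangent i φ := by rw [h1, smul_neg, smul_smul, ← neg_smul, div_eq_mul_inv, mul_comm, neg_mul]
  have hui : u i = -β / α := by
    have := congrFun hu' i
    rwa [Pi.smul_apply, tangent_self, smul_eq_mul, mul_one] at this
  rw [hui]; exact hu'

/-! ## The terminal move: every other letter contains the curve -/

/-- When every letter `l ≠ i` of `E` contains the curve (`φ_l = 0`), the graph shear straightens the letters of `E`. -/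
theorem shear_letters_of_terminal {i : Fin (m + 1)} {φ : Fin (m + 1) → PowerSeries k} {E : Finset (Fin (m + 1))}
    (hterm : ∀ l ∈ E, l ≠ i → φ l = 0) :
    ∀ l ∈ E, ∃ (l' : Fin (m + 1)) (u : MvPowerSeries (Fin (m + 1)) k), constantCoeff u ≠ 0 ∧ shear i φ l = u * X l' := by
  intro l hl
  refine ⟨l, 1, by rw [map_one]; exact one_ne_zero, ?_⟩
  rw [one_mul]
  by_cases hli : l = i
  · exact shear_eq_X_of_eq_zero (Or.inl hli)
  · exact shear_eq_X_of_eq_zero (Or.inr (hterm l hl hli))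

/-- **THE TERMINAL MOVE WINS THE HEAD PHASE** (OURS · L1 W4.3; S-E1-CURVE): from an admissibly decorated position whose product `g = f·∏_O x_l` of
order `c` has apex dimension `≤ 1` and a permissible GRAPH CURVE over the letter `x_i` contained in every OTHER boundary letter plane, the curve move
`(Φ_C, 𝟙_{j ≠ i})` is B-permissible and drops the head at every answer (`m ≥ 1`). -/
theorem dWinsTo_headDrop_of_graph_terminal [Infinite k] {b : MvPowerSeries (Fin (m + 1)) k} {δ : Decoration k m} (hadm : Admissible b δ)
    (hm : 0 < m) {i : Fin (m + 1)} {φ : Fin (m + 1) → PowerSeries k} (hφ : ∀ j, j ≠ i → PowerSeries.constantCoeff (φ j) = 0)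
    (hperm : InOffIdeal i δ.c (subst (shear i φ) (δ.f * ∏ l ∈ δ.O, X l)))
    (hterm : ∀ l ∈ δ.E, l ≠ i → φ l = 0)
    (hcol : ∀ u₁ u₂ : Fin (m + 1) → k,
      (∀ v, CobordantChart.initEval (fun _ : Fin (m + 1) => 1) (v + u₁) δ.c (δ.f * ∏ l ∈ δ.O, X l) =
        CobordantChart.initEval (fun _ : Fin (m + 1) => 1) v δ.c (δ.f * ∏ l ∈ δ.O, X l)) →
      (∀ v, CobordantChart.initEval (fun _ : Fin (m + 1) => 1) (v + u₂) δ.c (δ.f * ∏ l ∈ δ.O, X l) =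
        CobordantChart.initEval (fun _ : Fin (m + 1) => 1) v δ.c (δ.f * ∏ l ∈ δ.O, X l)) →
      ∃ α β : k, (α ≠ 0 ∨ β ≠ 0) ∧ α • u₁ + β • u₂ = 0) :
    DWinsTo (St := MvPowerSeries (Fin (m + 1)) k × Decoration k m) Prod.fst
      (fun τ => Admissible τ.1 τ.2 ∧ τ.2.head < δ.head) (b, δ) := by
  -- the weights `𝟙_{j ≠ i}`: a positive weight exists since `m ≥ 1`
  obtain ⟨j₀, hj₀⟩ : ∃ j₀ : Fin (m + 1), j₀ ≠ i := by
    by_cases hi : i = 0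
    · refine ⟨Fin.last m, fun h => ?_⟩
      have h1 := congrArg Fin.val (h.trans hi)
      rw [Fin.val_last, Fin.val_zero] at h1
      omega
    · exact ⟨0, fun h => hi h.symm⟩
  have hmv : IsCountMove (shear i φ) (fun j : Fin (m + 1) => if j = i then 0 else 1) :=
    isCountMove_shear hφ (fun j => by split_ifs <;> simp) ⟨j₀, by rw [if_neg hj₀]; exact Nat.one_pos⟩
  have hB : IsBPermissible δ (shear i φ) (fun j : Fin (m + 1) => if j = i then 0 else 1) :=
    isBPermissible_of_totalO_weightedOrder hadm hmv (shear_letters_of_terminal hterm) (le_weightedOrder_of_inOffIdeal hperm)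
  exact dWinsTo_headDrop_of_apexLine_curve hadm hB (l₀ := i) (if_pos rfl) hcol
-- BODY-END

end GraphCurve

end TameFourTupleDrop

end Summit.ResolutionOfSingularities.ResolutionOfSingularities.Theorems

end
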